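import Summits.ResolutionOfSingularities.ResolutionOfSingularities.Theorems.FrobeniusLadderFInjectiveMacaulayficationRoadBFrame
import Summits.ResolutionOfSingularities.ResolutionOfSingularities.Theorems.FrobeniusLadderFInjectiveMacaulayficationT11Char7FanData
import Summits.ResolutionOfSingularities.ResolutionOfSingularities.Theorems.FrobeniusLadderFInjectiveMacaulayficationT11Char7Poly
import Summits.ResolutionOfSingularities.ResolutionOfSingularities.Theorems.FrobeniusLadderFInjectiveMacaulayficationT11HypersurfacePrime
import Summits.ResolutionOfSingularities.ResolutionOfSingularities.Theorems.FrobeniusLadderFInjectiveMacaulayficationT11SpecimenDoorWide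
import Summits.ResolutionOfSingularities.ResolutionOfSingularities.Theorems.FrobeniusLadderFInjectiveMacaulayficationT11PlusOriginTransportStalk
import HarnessLib

/-!
# THE ROAD-B INSTANCE `T₁₁ / p` MODULO THE 87 CELL PACKAGES, EVERY PRIME `p ∉ {2, 3, 7}`: one frame for all remaining T₁₁ campaigns
# (crux `FInjectiveMacaulayfication`, road B; sequel to `T11OriginPointFixableChar7` (stub-1, p525959) / `…Char5` (p534747); seat res-L1-w45a-stub-2)

Support file for crux stmt-ResolutionOfSingularities-15315 (`FrobeniusLadder.FInjectiveMacaulayfication`), chain w45a. [OURS · L1 W4.5a] —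
NOT a statement of the manuscript [claim: Hironaka2017]; AI-written, weaker than expert review; no statement of the manuscript is used.

The instances at `p = 7` and `p = 5` differ ONLY in the 87 per-chart cell packages: the fan tables `T11Char7Fan.*`, the strict transforms
`T11Char7Poly.G`, the strata `T11Char7Poly.SS` and all fan-side binders are p-independent (REUSE AUDIT 2026-08-27T10:56:49Z), and the two
remaining p-dependent binders `hg0` / `hX` hold for EVERY prime `p ≠ 3` because every variable-free coefficient class of every `g_c` is `1` or `3`
(`coeffClass_raw`, one `decide +kernel`). This file states the frame ONCE for all such `p`, with the cell packages as the only hypothesis, and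
closes it with the characteristic-generic specimen door `T11SpecimenDoorWide.fInjectiveMacaulayfication_T11plus_of_ne` (`p ∉ {2, 3, 7}`, this seat)
and the stalk transport `T11PlusOriginTransportStalk.t11Plus_h0_of_hypersurface_h0` (I11). A future T₁₁/11 or T₁₁/13 campaign therefore consists of
the 18 generated cells files at that prime and the one-line instance `fInjectiveMacaulayfication_T11plus_of_cells p … (cells_all k)`:

* `coeffClass_raw`, `hX_raw`, `hX`, `hg0` — the `hX` / `hg0` binders for every prime `p ≠ 3`;
* `t11_originPointFixable_of_cells (p) (hp3) (Gs) (hG) (hcells)` — `PFix_p` at the origin of `T₁₁ = V(Gs 0)` from the 87 cell packages at `p`;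
* `fInjectiveMacaulayfication_T11plus_of_cells (p) (hp2 hp3 hp7) (Fs hF₀ hF₁) (hcells)` — **the crux conclusion for `T₁₁⁺/k`, `char k = p ∉ {2,3,7}`,
  modulo the 87 cell packages at `p`** (door ∘ stalk transport ∘ frame). (Check, not in this file to keep its imports light: the `p = 5`
  headline is `fInjectiveMacaulayfication_T11plus_of_cells 5 … (T11OriginPointFixableChar5.cells_all k)`, farm-verified in the seat's scratch.)

No definitions, no named facts. [folklore glue; the mathematics is the certificate]
-/

-- single-problem summit: the doubled namespace component is forced
set_option linter.dupNamespace false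

noncomputable section

open AlgebraicGeometry MvPolynomial

namespace Summit.ResolutionOfSingularities.ResolutionOfSingularities.Theorems.FInjectiveMacaulayfication.T11OriginPointFixableOfCells

open Summit.ResolutionOfSingularities.ResolutionOfSingularities.Theorems.FInjectiveMacaulayfication

/-! ## §1 `hX` / `hg0` for every prime `p ≠ 3` -/

/-- For every chart and variable, a term of `g_c` free of that variable whose coefficient class (the sum of the coefficients of the equal-exponent
terms) is `1` or `3` — the strict transforms of `T₁₁ = z² + w⁷ + y⁶ + 3y⁴x³ + 3y²x⁶ + x⁹ + x¹¹` have coefficients `1` and `3` only. [folklore] -/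
theorem coeffClass_raw : ∀ (c : Fin 87) (i : Fin 4), ∃ t ∈ T11Char7Poly.G c, t.2 i = 0 ∧
    ((((T11Char7Poly.G c).filter fun s : ℤ × (Fin 4 → ℕ) => s.2 = t.2).map fun s : ℤ × (Fin 4 → ℕ) => s.1).sum = 1 ∨
     (((T11Char7Poly.G c).filter fun s : ℤ × (Fin 4 → ℕ) => s.2 = t.2).map fun s : ℤ × (Fin 4 → ℕ) => s.1).sum = 3) := by
  decide +kernel

/-- `hX_raw` at every prime `p ≠ 3`: a variable-free term whose coefficient class is prime to `p`. [folklore] -/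
theorem hX_raw (p : ℕ) (hp : p.Prime) (hp3 : p ≠ 3) : ∀ (c : Fin 87) (i : Fin 4), ∃ t ∈ T11Char7Poly.G c, t.2 i = 0 ∧
    ¬ ((p : ℤ) ∣ (((T11Char7Poly.G c).filter fun s : ℤ × (Fin 4 → ℕ) => s.2 = t.2).map fun s : ℤ × (Fin 4 → ℕ) => s.1).sum) := by
  intro c i
  obtain ⟨t, ht, hti, hsum⟩ := coeffClass_raw c i
  refine ⟨t, ht, hti, fun hdvd => ?_⟩
  have hp1 : p ≠ 1 := hp.one_lt.ne'
  rcases hsum with h | h <;> rw [h] at hdvd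
  · exact hp1 (by exact_mod_cast Int.eq_one_of_dvd_one (by exact_mod_cast (Nat.zero_le p)) hdvd)
  · have h3 : p ∣ 3 := by exact_mod_cast hdvd
    rcases (Nat.dvd_prime Nat.prime_three).mp h3 with h1 | h1
    · exact hp1 h1
    · exact hp3 h1

/-- **`hX` at every prime `p ≠ 3`**: no variable divides a strict transform. [folklore] -/
theorem hX (p : ℕ) [Fact p.Prime] (hp3 : p ≠ 3) (k : Type) [Field k] [CharP k p] :
    ∀ (c : Fin 87) (i : Fin 4), ¬ (X i ∣ KLocCellKit.evalL k (T11Char7Poly.G c)) := by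
  intro c
  unfold KLocCellKit.evalL
  exact NotDvdOfSupport.forall_not_X_dvd_evalL p (T11Char7Poly.G c) (hX_raw p Fact.out hp3 c)

/-- **`hg0` at every prime `p ≠ 3`**: the strict transforms are non-zero. [folklore] -/
theorem hg0 (p : ℕ) [Fact p.Prime] (hp3 : p ≠ 3) (k : Type) [Field k] [CharP k p] :
    ∀ c : Fin 87, KLocCellKit.evalL k (T11Char7Poly.G c) ≠ 0 :=
  fun c h => hX p hp3 k c 0 (by rw [h]; exact dvd_zero _)

/-! ## §2 The frame modulo the cell packages -/

/-- **THE ROAD-B INSTANCE `T₁₁ / p` MODULO THE CELL PACKAGES**, every prime `p ≠ 3`: given the 87 per-chart cell packages at `p` over the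
tables `T11Char7Poly.G` / `T11Char7Poly.SS` (the `cells_all` theorem of a campaign's instance file), the origin of
`X = Spec k[x,y,z,w]/(z² + (y²+x³)³ + x¹¹ + w⁷)`, `char k = p`, is point-fixable (`PFix_p`, the `h0` shape of the specimen doors).
[OURS; folklore glue] -/
theorem t11_originPointFixable_of_cells (p : ℕ) [Fact p.Prime] (hp3 : p ≠ 3) (k : Type) [Field k] [CharP k p]
    (Gs : Fin 1 → MvPolynomial (Fin 4) k) (hG : Gs 0 = X 2 ^ 2 + (X 1 ^ 2 + X 0 ^ 3) ^ 3 + X 0 ^ 11 + X 3 ^ 7)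
    (hcells : ∀ (c : Fin 87), ∀ S ∈ T11Char7Poly.SS c,
      ∃ (L : List ((Fin 4 →₀ ℕ) × MvPolynomial (Fin 4) k)) (rr : List (MvPolynomial (Fin 4) k))
        (tt : Fin 4 → MvPolynomial (Fin 4) k) (t₀ : MvPolynomial (Fin 4) k),
        (L.map Prod.fst).Nodup ∧ (∀ e ∈ L, ∀ i : Fin 4, e.1 i < p) ∧
        KLocCellKit.evalL k (T11Char7Poly.G c) ^ (p - 1) = (L.map fun e => MvPolynomial.monomial e.1 (1 : k) * MvPolynomial.expand p e.2).sum ∧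
        (1 : MvPolynomial (Fin 4) k) = (List.zipWith (fun r e => r * MvPolynomial.expand p e.2) rr L).sum +
          ∑ i ∈ S, tt i * MvPolynomial.X i + t₀ * KLocCellKit.evalL k (T11Char7Poly.G c)) :
    ∀ b : Spec (.of (MvPolynomial (Fin 4) k ⧸ Ideal.span (Set.range Gs))),
      b.asIdeal = Ideal.span (Set.range fun j : Fin 4 => Ideal.Quotient.mk (Ideal.span (Set.range Gs)) (X j)) →
      ∃ (nc : ℕ) (c : Fin nc → (Spec (.of (MvPolynomial (Fin 4) k ⧸ Ideal.span (Set.range Gs)))).presheaf.stalk b),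
        Ideal.span (Set.range c) ≠ ⊥ ∧ (Ideal.span (Set.range c)).radical =
          IsLocalRing.maximalIdeal ((Spec (.of (MvPolynomial (Fin 4) k ⧸ Ideal.span (Set.range Gs)))).presheaf.stalk b) ∧
        ∀ (j : Fin nc) (𝔔 : PrimeSpectrum (Literature.AlgebraicGeometry.Resolution.blowupAlgebra (Ideal.span (Set.range c)) (c j))),
          𝔔.asIdeal.comap (algebraMap ((Spec (.of (MvPolynomial (Fin 4) k ⧸ Ideal.span (Set.range Gs)))).presheaf.stalk b)
            (Literature.AlgebraicGeometry.Resolution.blowupAlgebra (Ideal.span (Set.range c)) (c j))) =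
            IsLocalRing.maximalIdeal ((Spec (.of (MvPolynomial (Fin 4) k ⧸ Ideal.span (Set.range Gs)))).presheaf.stalk b) →
          IsDomain (Localization.AtPrime 𝔔.asIdeal) ∧ ∀ dd : ℕ, ringKrullDim (Localization.AtPrime 𝔔.asIdeal) = dd →
            ∀ s : Fin dd → Localization.AtPrime 𝔔.asIdeal, (Ideal.span (Set.range s)).radical.IsMaximal →
              RingTheory.Sequence.IsWeaklyRegular (Localization.AtPrime 𝔔.asIdeal) (List.ofFn s) ∧
              ∀ y : Localization.AtPrime 𝔔.asIdeal, (∃ e : ℕ, y ^ p ^ e ∈ Ideal.span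
                ((fun z : Localization.AtPrime 𝔔.asIdeal => z ^ p ^ e) '' (Ideal.span (Set.range s) : Set (Localization.AtPrime 𝔔.asIdeal)))) →
                y ∈ Ideal.span (Set.range s) := by
  -- `Gs = ![T₁₁]`, then substitute
  have e : Gs = ![X 2 ^ 2 + (X 1 ^ 2 + X 0 ^ 3) ^ 3 + X 0 ^ 11 + X 3 ^ 7] := by
    funext l
    fin_cases l
    exact hG
  subst e
  have hpr := T11HypersurfacePrime.t11_prime_and_X_ne_zero k
    (![X 2 ^ 2 + (X 1 ^ 2 + X 0 ^ 3) ^ 3 + X 0 ^ 11 + X 3 ^ 7] : Fin 1 → MvPolynomial (Fin 4) k) rfl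
  have hf0 : constantCoeff (X 2 ^ 2 + (X 1 ^ 2 + X 0 ^ 3) ^ 3 + X 0 ^ 11 + X 3 ^ 7 : MvPolynomial (Fin 4) k) = 0 := by
    simp [constantCoeff_X]
  exact RoadBFrame.originPointFixable_of_cells p k 4 87 T11Char7Fan.ht T11Char7Fan.A T11Char7Fan.hAJ T11Char7Fan.hprim
    T11Char7Fan.m (T11Char7Fan.hcov k) T11Char7Fan.V T11Char7Fan.hV T11Char7Fan.a T11Char7Fan.haA T11Char7Fan.hgen T11Char7Fan.hge
    (X 2 ^ 2 + (X 1 ^ 2 + X 0 ^ 3) ^ 3 + X 0 ^ 11 + X 3 ^ 7) hf0 hpr.1 hpr.2 T11Char7Poly.G T11Char7Fan.d (T11Char7Poly.hθF₀ k)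
    T11Char7Fan.hunit (T11Char7Fan.hzero k _) (hg0 p hp3 k) (hX p hp3 k) T11Char7Poly.SS T11Char7Poly.hSScov hcells

/-! ## §3 The crux conclusion for `T₁₁⁺` modulo the cell packages, `p ∉ {2, 3, 7}` -/

/-- **THE CRUX STATEMENT FOR `X = T₁₁⁺` OVER EVERY FIELD OF CHARACTERISTIC `p ∉ {2, 3, 7}`, MODULO THE 87 CELL PACKAGES AT `p`.**
`T₁₁⁺ = V(Φ − y² − x³, z² + Φ³ + x¹¹ + w⁷) ⊂ 𝔸⁵_k` has an F-injective Macaulayfication in the sense of the crux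
`FrobeniusLadder.FInjectiveMacaulayfication` as soon as the 87 kernel cell checks at `p` are supplied (`hcells` = a campaign's `cells_all`):
door `T11SpecimenDoorWide.fInjectiveMacaulayfication_T11plus_of_ne` ∘ stalk transport `T11PlusOriginTransportStalk.t11Plus_h0_of_hypersurface_h0` ∘
`t11_originPointFixable_of_cells`. [OURS · L1 W4.5a; AI-built, weaker than expert review; the certificate mathematics is res-L1-w45a-tri-1's] -/
theorem fInjectiveMacaulayfication_T11plus_of_cells (p : ℕ) [Fact p.Prime] (hp2 : p ≠ 2) (hp3 : p ≠ 3) (hp7 : p ≠ 7)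
    (k : Type) [Field k] [CharP k p] (Fs : Fin 2 → MvPolynomial (Fin 5) k)
    (hF₀ : Fs 0 = X 4 - X 1 ^ 2 - X 0 ^ 3) (hF₁ : Fs 1 = X 2 ^ 2 + X 4 ^ 3 + X 0 ^ 11 + X 3 ^ 7)
    (hcells : ∀ (c : Fin 87), ∀ S ∈ T11Char7Poly.SS c,
      ∃ (L : List ((Fin 4 →₀ ℕ) × MvPolynomial (Fin 4) k)) (rr : List (MvPolynomial (Fin 4) k))
        (tt : Fin 4 → MvPolynomial (Fin 4) k) (t₀ : MvPolynomial (Fin 4) k),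
        (L.map Prod.fst).Nodup ∧ (∀ e ∈ L, ∀ i : Fin 4, e.1 i < p) ∧
        KLocCellKit.evalL k (T11Char7Poly.G c) ^ (p - 1) = (L.map fun e => MvPolynomial.monomial e.1 (1 : k) * MvPolynomial.expand p e.2).sum ∧
        (1 : MvPolynomial (Fin 4) k) = (List.zipWith (fun r e => r * MvPolynomial.expand p e.2) rr L).sum +
          ∑ i ∈ S, tt i * MvPolynomial.X i + t₀ * KLocCellKit.evalL k (T11Char7Poly.G c)) :
    ∃ (X' : Scheme.{0}) (π : X' ⟶ (Spec (.of (MvPolynomial (Fin 5) k ⧸ Ideal.span (Set.range Fs))))),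
      IsProper π ∧ Literature.AlgebraicGeometry.Resolution.IsBirational π ∧
      ∀ x : X', IsDomain (X'.presheaf.stalk x) ∧ ∀ d : ℕ, ringKrullDim (X'.presheaf.stalk x) = d →
        ∀ s : Fin d → X'.presheaf.stalk x, (Ideal.span (Set.range s)).radical.IsMaximal →
          RingTheory.Sequence.IsWeaklyRegular (X'.presheaf.stalk x) (List.ofFn s) ∧
          ∀ y : X'.presheaf.stalk x, (∃ e : ℕ, y ^ p ^ e ∈ Ideal.span
            ((fun z : X'.presheaf.stalk x => z ^ p ^ e) '' (Ideal.span (Set.range s) : Set (X'.presheaf.stalk x)))) →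
            y ∈ Ideal.span (Set.range s) := by
  haveI : (Ideal.span (Set.range fun j : Fin 4 => Ideal.Quotient.mk (Ideal.span (Set.range
      (![X 2 ^ 2 + (X 1 ^ 2 + X 0 ^ 3) ^ 3 + X 0 ^ 11 + X 3 ^ 7] : Fin 1 → MvPolynomial (Fin 4) k))) (MvPolynomial.X j))).IsPrime :=
    (QuotientOriginMaximal.isMaximal_span_range_mk_X k
      (![X 2 ^ 2 + (X 1 ^ 2 + X 0 ^ 3) ^ 3 + X 0 ^ 11 + X 3 ^ 7] : Fin 1 → MvPolynomial (Fin 4) k)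
      (fun l => by fin_cases l; simp [constantCoeff_X])).isPrime
  exact T11SpecimenDoorWide.fInjectiveMacaulayfication_T11plus_of_ne p hp2 hp3 hp7 k Fs hF₀ hF₁
    (T11PlusOriginTransportStalk.t11Plus_h0_of_hypersurface_h0 k p Fs hF₀ hF₁
      (![X 2 ^ 2 + (X 1 ^ 2 + X 0 ^ 3) ^ 3 + X 0 ^ 11 + X 3 ^ 7] : Fin 1 → MvPolynomial (Fin 4) k) rfl
      (t11_originPointFixable_of_cells p hp3 k _ rfl hcells))

end Summit.ResolutionOfSingularities.ResolutionOfSingularities.Theorems.FInjectiveMacaulayfication.T11OriginPointFixableOfCells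

end
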